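/-
Origin: expansion seat `planner-pub-hodgecm-pohl-g15-0`, handover #9 2026-08-18T16:19:39Z (md5 b42e8d980b542fc4ce9d8b2bf22b5b94, 298 l.; RUN-32 CANDIDATE ROW, ON REQUEST ONLY — TREE-SHAPE SPLIT (≤400 l.) of the pohl lineage, source lines verbatim; REPLACES HodgeCM/Proofs/Pohlmann/AnyCMField.lean in place (module name kept ⇒ no importer edits); lands AFTER AnyCMFieldInclusions; rewrites import Pohl15.AnyCMFieldInclusions -> HodgeCM.Proofs.Pohlmann.AnyCMFieldInclu (`HOME/pub-hodgecm-pohl-g15/lean/Pohl15/AnyCMField.lean`, md5 b42e8d98, 298 lines);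
landed by the packager successor (mc-unitary-1-g3, gen-8 kit) in gate run 32 REPLACES the earlier landed copy of `HodgeCM/Proofs/Pohlmann/AnyCMField.lean` (import ^import Pohl15\.AnyCMFieldInclusions[ \t]*$→import HodgeCM.Proofs.Pohlmann.AnyCMFieldInclusions ×1).
-/
/-
Copyright: pub-hodgecm formalisation cell (harness21, 2026). New file (not vendored).
Origin: HOME/pub-hodgecm-pohl-g15/lean/Pohl15/AnyCMField.lean — session planner-pub-hodgecm-pohl-g15-0 (unit pub-hodgecm-pohl-g15),
EXPANSION part (b) `PohlmannSpan`, generation 15: TREE-SHAPE STAGING under the 400-line rule of lean/CONVENTIONS.md §2 — part 3/3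
of the split of `HodgeCM/Proofs/Pohlmann/AnyCMField.lean` (pohl-g9, gate run 26; 723 l., md5 9785dda4ddb5): source lines 518–723 VERBATIM; the module docstring below is the source's, with one `Layout` sentence appended.
Intended final place: `HodgeCM/Proofs/Pohlmann/AnyCMField.lean` (module `HodgeCM.Proofs.Pohlmann.AnyCMField`); WIP import `Pohl15.AnyCMFieldInclusions` → `HodgeCM.Proofs.Pohlmann.AnyCMFieldInclusions` on landing.  The LAST part keeps the old module name, so no importer changes.
-/
import Summits.HodgeConjecture.HodgeCM.Proofs.Pohlmann.AnyCMFieldInclusions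

/-!
# Pohlmann's theorem (Gao–Ullmo Thm 3.1) for an ARBITRARY CM field `F`: the hypothesis `IsGalois ℚ F` removed

Gao–Ullmo, *J. Inst. Math. Jussieu* **25** (2025) 215–249 (= arXiv:2411.12249), Theorem 3.1 "(Pohlmann)"
[corpus:paper:arxiv-2411.12249 p0009 L32–L39], verbatim: "For each `p ≥ 0`, the vector space `B^p(A) ⊗ ℂ` has a basis
consisting of `[P]` for those ordered sets `P ∈ 𝒫(S)` with `|P| = 2p` such that `|σP ∩ Φ| = |σP ∩ Φ̄|` for all `σ ∈ G`.
In particular `dim_ℚ B^p(A)` is the number of ordered `P ∈ 𝒫(S)` with `|P| = 2p` satisfying (3.2)."  Here `A` is the CM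
abelian variety of an ARBITRARY CM pair `(E, Φ)` — `E` "a finite product of CM fields" [loc. cit. §2.1, p0006 L9] — and
`G = Gal(E^c/ℚ)` for "the Galois closure `E^c` of a CM algebra `E` … the composite of the Galois closures of `E₁, …, E_m`
in `ℚ̄`.  Then the Galois group `G := Gal(E^c/ℚ)` acts on `Hom(E, ℂ) = Φ ⊔ Φ̄`" [p0006 L15]; and [p0009 L42]: "Pohlmann [Poh]
states this result when `A` is simple. The proof remains valid for an arbitrary CM abelian variety `A`."

STATE OF THE PACKAGE BEFORE THIS FILE.  The product form of this theorem over the package's geometric universe —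
`Universe.PohlmannSpan` (Geometry/WeightVectors.lean; `⊆`), `Universe.PohlmannBasis` (Proofs/Pohlmann/PohlmannEq.lean; `=`),
`Universe.PohlmannTheorem31` (Proofs/Pohlmann/WeightLines.lean; basis + dimension, `p ≥ 1`) — is stated and proved
(`pohlmannSpan_of_facts`, `pohlmannBasis_of_facts`, `pohlmannTheorem31_of_facts`, from `ModelAxioms` + the textbook facts
N1–N4) ONLY for `F` GALOIS over `ℚ`, because the index condition `IsHodgeWeight Θ p S` (CM/LefschetzChar.lean) phrases
"for all `σ ∈ G`" with the group `GalT F` of Galois translates of `Hom(F, ℂ)`, which for non-Galois `F` can be LARGER than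
the image of `Gal(E^c/ℚ)` (GaoUllmoDictionary.lean, "REMARK (scope)": for non-Galois `F` only `Hodge weight ⇒ (3.2)` was
known, and `IsHodgeWeight` is a priori stronger than (3.2)).

THIS FILE removes the restriction, i.e. proves the theorem in the generality of the source on the `F`-axis: for EVERY CM
field `F` (bundled `CMField`: a `NumberField.IsCMField`), every `n`, every family of CM types `Θ : Fin (n+1) → CMType F` and
every `p`, with the index set read EXACTLY as in the source — through the action of `Gal(E^c/ℚ)`, `E = F^{n+1}`, on
`Hom(E, ℂ) = ⊔_j Hom(F, ℂ)` (`GaoUllmo.galoisClosure`, `GaoUllmo.galAct`, `GaoUllmo.galF`; Literature/GaoUllmo.lean and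
Proofs/Pohlmann/GaoUllmoDictionary.lean):

* `HodgeCM.IsHodgeWeightC Θ p S` — `Σ_j |S_j| = 2p` and `#{(j,s) ∈ S : σ ∘ s ∈ Θ_j} = p` for every `σ ∈ Gal(E^c/ℚ)`;
  `GaoUllmo.isHodgeWeightC_iff_satisfiesEq32` — this IS `|P_S| = 2p ∧ (3.2)` for the set `P_S ⊆ Hom(E, ℂ)` (KERNEL, any
  `F`; `GaoUllmo.finrank_Bp_pi_eq_card_hodgeWeightC`: in Gao–Ullmo's model `dim_ℚ B^p = #{S // IsHodgeWeightC Θ p S}`);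
  `IsHodgeWeight.isHodgeWeightC` (any `F`) and `isHodgeWeight_iff_isHodgeWeightC` (`F` Galois: the old index set);
* `Universe.PohlmannBasisCM` — `B^p(A′) ⊗ ℂ = ⨆_{S : IsHodgeWeightC} V_S` for `A′ = ∏_j A_{(F,Θ_j)}`, ANY CM field `F`, all
  `p ≥ 0`; proved: `pohlmannBasisCM_holds (M) (h29) (h30)`, `pohlmannBasisCM_of_facts (M) (hN1) (hN2) (hN3) (hN4)`; the sum is
  direct (`iSupIndep_weightSpace_hodgeC`);
* `Universe.PohlmannSpanCM` (`⊆`, the shape of `PohlmannSpan` without `IsGalois ℚ F → 6 ≤ finrank ℚ F →`),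
  `Universe.PohlmannTheorem31CM` (basis indexed by `{S // IsHodgeWeightC Θ p S}` + `dim_ℚ B^p(A′) = #{S // IsHodgeWeightC}`,
  `p ≥ 1`; `_of_facts` from `ModelAxioms` + N1–N4) and `Universe.PohlmannTheorem31AllCM` (the same for EVERY `p ≥ 0`;
  `_of_connected` from N1–N4 + `CMProdConnected`, `_of_facts` from N1–N4 + F6, exactly the inputs of the Galois all-degree form
  `PohlmannTheorem31All`, Proofs/Pohlmann/DegreeZero.lean);
* the Galois statements are COROLLARIES: `pohlmannBasis_of_pohlmannBasisCM`, `pohlmannSpan_of_pohlmannSpanCM`,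
  `pohlmannTheorem31_of_pohlmannTheorem31CM`, `pohlmannTheorem31All_of_pohlmannTheorem31AllCM` (pure logic +
  `isHodgeWeight_iff_isHodgeWeightC`);
* CROSS-MODEL, any CM field `F`: `finrank_hodgeClassesOf_eq_finrank_Bp_CM` (`p ≥ 1`, N1–N4),
  `finrank_hodgeClassesOf_eq_finrank_Bp_allCM` (every `p`, + `CMProdConnected`) / `_CM_of_facts` (+ F6) — the package's
  `dim_ℚ B^p(A′)` EQUALS `dim_ℚ B^p` of Gao–Ullmo's own model of `A_{(F^{n+1}, ⊔_j Θ_j)}` (the kernel-proved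
  `GaoUllmo.Theorem31_finrank_holds`), extending `finrank_hodgeClassesOf_eq_finrank_Bp` (GaoUllmoCrossModel.lean) and
  `finrank_hodgeClassesOf_eq_finrank_Bp_all` (DegreeZeroCrossModel.lean), both Galois `F` only.

PROOF (what changes w.r.t. the Galois proofs of PohlmannSpan.lean §4 and PohlmannEq.lean (1)).  There, the eigencharacter
`λ(S) = Σ_i c_i ∏_{s ∈ S_{j_i}} s(a_i)` of the rational separating operator `T` was written `λ(S) = σ₀(y_S)` with `y_S ∈ F`
through ONE embedding `σ₀` (this needs `σ₀(F) ⊇ s(F)` for all `s`, i.e. `F` Galois), and Galois conjugates were produced by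
`Gal(F/ℚ)` (Mathlib `IsConjRoot`).  Here `λ(S)` is read as an element `λ^c(S)` of the Galois closure `E^c ⊂ ℂ`
(`Universe.sepValC`; each `s(a_i) = (s ∘ pr₀)(diag a_i) ∈ E^c`), and:
(⊆) `σ(λ^c(S)) = λ(σ · S)` for `σ ∈ Gal(E^c/ℚ)` (`coe_gal_sepValC`), and roots in `E^c` of the RATIONAL polynomial
    `charpoly(T|_B)` are permuted by `Gal(E^c/ℚ)` (`isRoot_algHom_of_isRoot`) — so the set `T_B` of weights met by `B_ℂ` is
    `Gal(E^c/ℚ)`-stable (`meets_permWeight_galTOf`), whence every `S ∈ T_B` satisfies `IsHodgeWeightC` (`isHodgeWeightC_of_meets`);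
(⊇) a complex root `μ` of `minpoly_ℚ(λ^c(S))` is `ψ(λ^c(S))` for an EMBEDDING `ψ : E^c → ℂ` (Mathlib
    `Algebra.IsAlgebraic.range_eval_eq_rootSet_minpoly`, `E^c/ℚ` finite: `GaoUllmo.finiteDimensional_galoisClosure`), and
    `ψ = σ_ψ|` for the automorphism `σ_ψ = GaoUllmo.autOfEmb ψ ∈ Gal(E^c/ℚ)` (a number field embedded into itself), so
    `μ = λ(σ_ψ · S)` (`algHom_sepValC_eq`) with `σ_ψ · S` again an `IsHodgeWeightC` weight (`isHodgeWeightC_permWeight`);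
    the rest of PohlmannEq.lean (1)–(2) is unchanged (`weightSpace_le_baseChange_hodgeClassesOf_C`).
Nothing is posited: no axiom, no placeholder, every hypothesis is `ModelAxioms` / `Fact_*` exactly as in the Galois files.

Layout (2026-08-18, tree 400-line rule): the dictionary / eigencharacter sections are now `AnyCMFieldDictionary.lean` and the two inclusions with the print statements `PohlmannBasisCM` / `PohlmannSpanCM` are `AnyCMFieldInclusions.lean` (a chain of imports ending here); this file keeps `section Lines` (basis and dimension) and the cross-model identity; all statements verbatim.
-/

noncomputable section

open scoped TensorProduct NumberField BigOperators
open Polynomial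

namespace HodgeCM

open Literature.AlgebraicGeometry.Motives (CMType HodgeStructure)
open Literature.AlgebraicGeometry.Motives.HodgeStructure (ofRat ofRat_apply)
open HodgeCM.Pohlmann HodgeCM.GaoUllmo HodgeCM.CMTypeOps

attribute [local instance] Classical.propDecidable

namespace Universe

variable {U : Universe}

/-! ### Basis and dimension, any CM field: `p ≥ 1` from N1–N4, every `p ≥ 0` with `CMProdConnected` -/

section Lines

variable {F : CMField} {n : ℕ} {Θ : Fin (n + 1) → CMType F}

/-- The basis of `B^p(A′) ⊗ ℂ` indexed by the Galois-closure Hodge weights, GIVEN that each of their weight spaces is a line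
(the one input that depends on the degree: `finrank_weightSpace` for `p ≥ 1`, `finrank_weightSpace_all` for all `p`). -/
theorem exists_basis_hodgeClassesOf_C_of_lines (M : U.ModelAxioms) (hN1 : U.Fact_cupExterior) (hN2 : U.Fact_cup_hodge)
    (hN3 : U.Fact_pull_H0) (hN4 : U.Fact_hodge_F0) (p : ℕ)
    (hl : ∀ S : Fin (n + 1) → Finset ((F : Type) →+* ℂ), IsHodgeWeightC Θ p S →
      Module.finrank ℂ (U.weightSpace F Θ S (2 * p)) = 1) :
    ∃ b : Module.Basis {S : Fin (n + 1) → Finset ((F : Type) →+* ℂ) // IsHodgeWeightC Θ p S} ℂ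
        ↥((U.hodgeClassesOf (U.cmProd F Θ) p).baseChange ℂ),
      ∀ S, ((b S : ↥((U.hodgeClassesOf (U.cmProd F Θ) p).baseChange ℂ)) : U.CohC (U.cmProd F Θ) (2 * p)) ∈
        U.weightSpace F Θ S.1 (2 * p) := by
  classical
  have h1 : ∀ S : {S : Fin (n + 1) → Finset ((F : Type) →+* ℂ) // IsHodgeWeightC Θ p S},
      Module.finrank ℂ (U.weightSpace F Θ S.1 (2 * p)) = 1 := fun S => hl S.1 S.2
  have hne : ∀ S : {S : Fin (n + 1) → Finset ((F : Type) →+* ℂ) // IsHodgeWeightC Θ p S},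
      ∃ v ∈ U.weightSpace F Θ S.1 (2 * p), v ≠ 0 := fun S => by
    apply Submodule.exists_mem_ne_zero_of_ne_bot
    intro h
    have h' := h1 S
    rw [h, finrank_bot] at h'
    exact zero_ne_one h'
  choose v hv hv0 using hne
  have hli : LinearIndependent ℂ v :=
    iSupIndep.linearIndependent _ (iSupIndep_weightSpace_hodgeC M p) hv hv0
  have hline : ∀ S, U.weightSpace F Θ S.1 (2 * p) = ℂ ∙ v S := fun S =>
    (Submodule.eq_of_le_of_finrank_le ((Submodule.span_singleton_le_iff_mem _ _).mpr (hv S))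
      (by rw [h1 S, finrank_span_singleton (hv0 S)])).symm
  have hspan : Submodule.span ℂ (Set.range v) = (U.hodgeClassesOf (U.cmProd F Θ) p).baseChange ℂ := by
    rw [pohlmannBasisCM_of_facts M hN1 hN2 hN3 hN4 F n Θ p, iSup_subtype', Submodule.span_range_eq_iSup]
    exact iSup_congr fun S => (hline S).symm
  refine ⟨(Module.Basis.span hli).map (LinearEquiv.ofEq _ _ hspan), fun S => ?_⟩
  rw [Module.Basis.map_apply, LinearEquiv.coe_ofEq_apply, Module.Basis.span_apply]
  exact hv S

/-- … and then `dim_ℚ B^p(A′) = #{S // IsHodgeWeightC Θ p S}`. -/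
theorem finrank_hodgeClassesOf_C_of_lines (M : U.ModelAxioms) (hN1 : U.Fact_cupExterior) (hN2 : U.Fact_cup_hodge)
    (hN3 : U.Fact_pull_H0) (hN4 : U.Fact_hodge_F0) (p : ℕ)
    (hl : ∀ S : Fin (n + 1) → Finset ((F : Type) →+* ℂ), IsHodgeWeightC Θ p S →
      Module.finrank ℂ (U.weightSpace F Θ S (2 * p)) = 1) :
    Module.finrank ℚ (U.hodgeClassesOf (U.cmProd F Θ) p) =
      Nat.card {S : Fin (n + 1) → Finset ((F : Type) →+* ℂ) // IsHodgeWeightC Θ p S} := by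
  obtain ⟨b, -⟩ := exists_basis_hodgeClassesOf_C_of_lines (Θ := Θ) M hN1 hN2 hN3 hN4 p hl
  rw [← Module.finrank_eq_nat_card_basis b,
    ← (Submodule.toBaseChange.toLinearEquiv ℂ (U.hodgeClassesOf (U.cmProd F Θ) p)).finrank_eq,
    Module.finrank_baseChange]

/-- **Gao–Ullmo Thm 3.1 (Pohlmann), basis form, any CM field `F`**, `p ≥ 1`: `B^p(A′) ⊗ ℂ` has a basis indexed by the
Galois-closure Hodge weights whose `S`-th vector is a weight vector of weight `S`.  Inputs: `ModelAxioms` + N1–N4. -/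
theorem exists_basis_hodgeClassesOf_C (M : U.ModelAxioms) (hN1 : U.Fact_cupExterior) (hN2 : U.Fact_cup_hodge)
    (hN3 : U.Fact_pull_H0) (hN4 : U.Fact_hodge_F0) {p : ℕ} (hp : 0 < p) :
    ∃ b : Module.Basis {S : Fin (n + 1) → Finset ((F : Type) →+* ℂ) // IsHodgeWeightC Θ p S} ℂ
        ↥((U.hodgeClassesOf (U.cmProd F Θ) p).baseChange ℂ),
      ∀ S, ((b S : ↥((U.hodgeClassesOf (U.cmProd F Θ) p).baseChange ℂ)) : U.CohC (U.cmProd F Θ) (2 * p)) ∈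
        U.weightSpace F Θ S.1 (2 * p) :=
  exists_basis_hodgeClassesOf_C_of_lines M hN1 hN2 hN3 hN4 p fun S hS => by
    rw [finrank_weightSpace M hN1 (by omega) S, if_pos hS.1]

/-- **"In particular `dim_ℚ B^p(A)` is the number of" Galois-closure Hodge weights**, any CM field `F`, `p ≥ 1`. -/
theorem finrank_hodgeClassesOf_C (M : U.ModelAxioms) (hN1 : U.Fact_cupExterior) (hN2 : U.Fact_cup_hodge)
    (hN3 : U.Fact_pull_H0) (hN4 : U.Fact_hodge_F0) {p : ℕ} (hp : 0 < p) :
    Module.finrank ℚ (U.hodgeClassesOf (U.cmProd F Θ) p) =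
      Nat.card {S : Fin (n + 1) → Finset ((F : Type) →+* ℂ) // IsHodgeWeightC Θ p S} :=
  finrank_hodgeClassesOf_C_of_lines M hN1 hN2 hN3 hN4 p fun S hS => by
    rw [finrank_weightSpace M hN1 (by omega) S, if_pos hS.1]

/-- The basis form for EVERY `p ≥ 0`, any CM field `F`, with the degree-`0` input `CMProdConnected` (`dim_ℚ H⁰(A′) = 1`;
a THEOREM of `ModelAxioms` + N1 + N3 + F6, `cmProdConnected_of_facts`, Proofs/Pohlmann/DegreeZero.lean). -/
theorem exists_basis_hodgeClassesOf_allC (M : U.ModelAxioms) (hN1 : U.Fact_cupExterior) (hN2 : U.Fact_cup_hodge)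
    (hN3 : U.Fact_pull_H0) (hN4 : U.Fact_hodge_F0) (h0 : U.CMProdConnected) (p : ℕ) :
    ∃ b : Module.Basis {S : Fin (n + 1) → Finset ((F : Type) →+* ℂ) // IsHodgeWeightC Θ p S} ℂ
        ↥((U.hodgeClassesOf (U.cmProd F Θ) p).baseChange ℂ),
      ∀ S, ((b S : ↥((U.hodgeClassesOf (U.cmProd F Θ) p).baseChange ℂ)) : U.CohC (U.cmProd F Θ) (2 * p)) ∈
        U.weightSpace F Θ S.1 (2 * p) :=
  exists_basis_hodgeClassesOf_C_of_lines M hN1 hN2 hN3 hN4 p fun S hS => by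
    rw [finrank_weightSpace_all M hN1 hN3 h0 (2 * p) S, if_pos hS.1]

/-- `dim_ℚ B^p(A′) = #{S // IsHodgeWeightC Θ p S}` for EVERY `p ≥ 0`, any CM field `F` (+ `CMProdConnected`). -/
theorem finrank_hodgeClassesOf_allC (M : U.ModelAxioms) (hN1 : U.Fact_cupExterior) (hN2 : U.Fact_cup_hodge)
    (hN3 : U.Fact_pull_H0) (hN4 : U.Fact_hodge_F0) (h0 : U.CMProdConnected) (p : ℕ) :
    Module.finrank ℚ (U.hodgeClassesOf (U.cmProd F Θ) p) =
      Nat.card {S : Fin (n + 1) → Finset ((F : Type) →+* ℂ) // IsHodgeWeightC Θ p S} :=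
  finrank_hodgeClassesOf_C_of_lines M hN1 hN2 hN3 hN4 p fun S hS => by
    rw [finrank_weightSpace_all M hN1 hN3 h0 (2 * p) S, if_pos hS.1]

end Lines

/-- **Gao–Ullmo Thm 3.1 "(Pohlmann)", both sentences, product form, `p ≥ 1`, for an ARBITRARY CM field `F`**:
(i) `B^p(A′) ⊗ ℂ` has a basis indexed by `{S // IsHodgeWeightC Θ p S}` whose `S`-th member is a weight vector of weight `S`;
(ii) `dim_ℚ B^p(A′) = #{S // IsHodgeWeightC Θ p S}`.  Compare `PohlmannTheorem31` (`F` Galois;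
`pohlmannTheorem31_of_pohlmannTheorem31CM`) and `PohlmannTheorem31AllCM` (every `p ≥ 0`). -/
def PohlmannTheorem31CM (U : Universe) : Prop :=
  ∀ (F : CMField) (n : ℕ) (Θ : Fin (n + 1) → CMType F) (p : ℕ), 0 < p →
    (∃ b : Module.Basis {S : Fin (n + 1) → Finset ((F : Type) →+* ℂ) // IsHodgeWeightC Θ p S} ℂ
        ↥((U.hodgeClassesOf (U.cmProd F Θ) p).baseChange ℂ),
      ∀ S, ((b S : ↥((U.hodgeClassesOf (U.cmProd F Θ) p).baseChange ℂ)) : U.CohC (U.cmProd F Θ) (2 * p)) ∈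
        U.weightSpace F Θ S.1 (2 * p)) ∧
    Module.finrank ℚ (U.hodgeClassesOf (U.cmProd F Θ) p) =
      Nat.card {S : Fin (n + 1) → Finset ((F : Type) →+* ℂ) // IsHodgeWeightC Θ p S}

/-- **Gao–Ullmo Thm 3.1 "(Pohlmann)", both sentences, product form, EVERY `p ≥ 0`, for an ARBITRARY CM field `F`** —
`PohlmannTheorem31All` (Proofs/Pohlmann/DegreeZero.lean) with `IsGalois ℚ F →` deleted and the index set `IsHodgeWeightC`. -/
def PohlmannTheorem31AllCM (U : Universe) : Prop :=
  ∀ (F : CMField) (n : ℕ) (Θ : Fin (n + 1) → CMType F) (p : ℕ),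
    (∃ b : Module.Basis {S : Fin (n + 1) → Finset ((F : Type) →+* ℂ) // IsHodgeWeightC Θ p S} ℂ
        ↥((U.hodgeClassesOf (U.cmProd F Θ) p).baseChange ℂ),
      ∀ S, ((b S : ↥((U.hodgeClassesOf (U.cmProd F Θ) p).baseChange ℂ)) : U.CohC (U.cmProd F Θ) (2 * p)) ∈
        U.weightSpace F Θ S.1 (2 * p)) ∧
    Module.finrank ℚ (U.hodgeClassesOf (U.cmProd F Θ) p) =
      Nat.card {S : Fin (n + 1) → Finset ((F : Type) →+* ℂ) // IsHodgeWeightC Θ p S}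

/-- **Gao–Ullmo Thm 3.1 (basis + dimension form, `p ≥ 1`) for every CM field, from the model axioms and N1–N4.** -/
theorem pohlmannTheorem31CM_of_facts (M : U.ModelAxioms) (hN1 : U.Fact_cupExterior) (hN2 : U.Fact_cup_hodge)
    (hN3 : U.Fact_pull_H0) (hN4 : U.Fact_hodge_F0) : U.PohlmannTheorem31CM := fun F n Θ p hp =>
  ⟨exists_basis_hodgeClassesOf_C (F := F) (n := n) (Θ := Θ) (p := p) M hN1 hN2 hN3 hN4 hp,
    finrank_hodgeClassesOf_C (F := F) (n := n) (Θ := Θ) (p := p) M hN1 hN2 hN3 hN4 hp⟩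

/-- **Thm 3.1 for every `p ≥ 0` and every CM field, from the model axioms, N1–N4 and `CMProdConnected`.** -/
theorem pohlmannTheorem31AllCM_of_connected (M : U.ModelAxioms) (hN1 : U.Fact_cupExterior) (hN2 : U.Fact_cup_hodge)
    (hN3 : U.Fact_pull_H0) (hN4 : U.Fact_hodge_F0) (h0 : U.CMProdConnected) : U.PohlmannTheorem31AllCM :=
  fun F n Θ p =>
    ⟨exists_basis_hodgeClassesOf_allC (F := F) (n := n) (Θ := Θ) M hN1 hN2 hN3 hN4 h0 p,
      finrank_hodgeClassesOf_allC (F := F) (n := n) (Θ := Θ) M hN1 hN2 hN3 hN4 h0 p⟩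

/-- **Thm 3.1 for every `p ≥ 0` and every CM field, from the model axioms, N1–N4 and F6 `Fact_weightDual`** (all binders
already adjudicated for `Assembly.COR_CM_of_geometricFacts`; no new fact). -/
theorem pohlmannTheorem31AllCM_of_facts (M : U.ModelAxioms) (hN1 : U.Fact_cupExterior) (hN2 : U.Fact_cup_hodge)
    (hN3 : U.Fact_pull_H0) (hN4 : U.Fact_hodge_F0) (h6 : U.Fact_weightDual) : U.PohlmannTheorem31AllCM :=
  pohlmannTheorem31AllCM_of_connected M hN1 hN2 hN3 hN4 (cmProdConnected_of_facts M hN1 hN3 h6)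

/-- `PohlmannTheorem31AllCM → PohlmannTheorem31CM`. -/
theorem pohlmannTheorem31CM_of_allCM (h : U.PohlmannTheorem31AllCM) : U.PohlmannTheorem31CM :=
  fun F n Θ p _ => h F n Θ p

/-- The Galois statement is a corollary: `PohlmannTheorem31CM → PohlmannTheorem31` (reindex the basis along
`{S // IsHodgeWeight Θ p S} ≃ {S // IsHodgeWeightC Θ p S}`, `F` Galois). -/
theorem pohlmannTheorem31_of_pohlmannTheorem31CM (h : U.PohlmannTheorem31CM) : U.PohlmannTheorem31 := by
  intro F hG n Θ p hp
  obtain ⟨⟨b, hb⟩, hdim⟩ := h F n Θ p hp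
  let e : {S : Fin (n + 1) → Finset ((F : Type) →+* ℂ) // IsHodgeWeight Θ p S} ≃
      {S : Fin (n + 1) → Finset ((F : Type) →+* ℂ) // IsHodgeWeightC Θ p S} :=
    Equiv.subtypeEquivRight fun S => isHodgeWeight_iff_isHodgeWeightC Θ p S
  refine ⟨⟨b.reindex e.symm, fun S => ?_⟩, by rw [hdim, Nat.card_congr e.symm]⟩
  rw [Module.Basis.reindex_apply, Equiv.symm_symm]
  exact hb (e S)

/-- The Galois all-degree statement is a corollary: `PohlmannTheorem31AllCM → PohlmannTheorem31All`. -/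
theorem pohlmannTheorem31All_of_pohlmannTheorem31AllCM (h : U.PohlmannTheorem31AllCM) : U.PohlmannTheorem31All := by
  intro F hG n Θ p
  obtain ⟨⟨b, hb⟩, hdim⟩ := h F n Θ p
  let e : {S : Fin (n + 1) → Finset ((F : Type) →+* ℂ) // IsHodgeWeight Θ p S} ≃
      {S : Fin (n + 1) → Finset ((F : Type) →+* ℂ) // IsHodgeWeightC Θ p S} :=
    Equiv.subtypeEquivRight fun S => isHodgeWeight_iff_isHodgeWeightC Θ p S
  refine ⟨⟨b.reindex e.symm, fun S => ?_⟩, by rw [hdim, Nat.card_congr e.symm]⟩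
  rw [Module.Basis.reindex_apply, Equiv.symm_symm]
  exact hb (e S)

/-! ### The cross-model identity, any CM field -/

/-- **CROSS-MODEL, any CM field `F`, `p ≥ 1`**: the package's `dim_ℚ B^p(∏_j A_{(F,Θ_j)})` (`ModelAxioms` + N1–N4) equals
`dim_ℚ B^p` of Gao–Ullmo's model of `A_{(F^{n+1}, ⊔_j Θ_j)}` (kernel `Theorem31_finrank_holds`), for any ordering of
`Hom(F^{n+1}, ℂ)` obeying the paper's convention (compare `finrank_hodgeClassesOf_eq_finrank_Bp`, Galois `F`). -/
theorem finrank_hodgeClassesOf_eq_finrank_Bp_CM (M : U.ModelAxioms) (hN1 : U.Fact_cupExterior)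
    (hN2 : U.Fact_cup_hodge) (hN3 : U.Fact_pull_H0) (hN4 : U.Fact_hodge_F0) (F : CMField) {n : ℕ}
    (Θ : Fin (n + 1) → CMType F) [LinearOrder (Emb (Fin (n + 1) → (F : Type)))] (hord : OrderConvention (piCMType Θ))
    {p : ℕ} (hp : 0 < p) :
    Module.finrank ℚ (U.hodgeClassesOf (U.cmProd F Θ) p) = Module.finrank ℚ (Bp (piCMType Θ) p) := by
  rw [finrank_hodgeClassesOf_C (F := F) (n := n) (Θ := Θ) M hN1 hN2 hN3 hN4 hp,
    finrank_Bp_pi_eq_card_hodgeWeightC Θ hord p]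

/-- **CROSS-MODEL, any CM field `F`, EVERY `p ≥ 0`** (+ `CMProdConnected`; compare `finrank_hodgeClassesOf_eq_finrank_Bp_all`,
Galois `F`). -/
theorem finrank_hodgeClassesOf_eq_finrank_Bp_allCM (M : U.ModelAxioms) (hN1 : U.Fact_cupExterior)
    (hN2 : U.Fact_cup_hodge) (hN3 : U.Fact_pull_H0) (hN4 : U.Fact_hodge_F0) (h0 : U.CMProdConnected) (F : CMField)
    {n : ℕ} (Θ : Fin (n + 1) → CMType F) [LinearOrder (Emb (Fin (n + 1) → (F : Type)))]
    (hord : OrderConvention (piCMType Θ)) (p : ℕ) :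
    Module.finrank ℚ (U.hodgeClassesOf (U.cmProd F Θ) p) = Module.finrank ℚ (Bp (piCMType Θ) p) := by
  rw [finrank_hodgeClassesOf_allC (F := F) (n := n) (Θ := Θ) M hN1 hN2 hN3 hN4 h0 p,
    finrank_Bp_pi_eq_card_hodgeWeightC Θ hord p]

/-- The same from the adjudicated binders `ModelAxioms` + N1–N4 + F6, any CM field `F`, every `p ≥ 0`. -/
theorem finrank_hodgeClassesOf_eq_finrank_Bp_CM_of_facts (M : U.ModelAxioms) (hN1 : U.Fact_cupExterior)
    (hN2 : U.Fact_cup_hodge) (hN3 : U.Fact_pull_H0) (hN4 : U.Fact_hodge_F0) (h6 : U.Fact_weightDual) (F : CMField)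
    {n : ℕ} (Θ : Fin (n + 1) → CMType F) [LinearOrder (Emb (Fin (n + 1) → (F : Type)))]
    (hord : OrderConvention (piCMType Θ)) (p : ℕ) :
    Module.finrank ℚ (U.hodgeClassesOf (U.cmProd F Θ) p) = Module.finrank ℚ (Bp (piCMType Θ) p) :=
  finrank_hodgeClassesOf_eq_finrank_Bp_allCM M hN1 hN2 hN3 hN4 (cmProdConnected_of_facts M hN1 hN3 h6) F Θ hord p

/-- The same with the order convention discharged (`GaoUllmo.exists_orderConvention`), any CM field `F`, every `p ≥ 0`. -/
theorem exists_order_finrank_hodgeClassesOf_eq_finrank_Bp_CM (M : U.ModelAxioms) (hN1 : U.Fact_cupExterior)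
    (hN2 : U.Fact_cup_hodge) (hN3 : U.Fact_pull_H0) (hN4 : U.Fact_hodge_F0) (h6 : U.Fact_weightDual) (F : CMField)
    {n : ℕ} (Θ : Fin (n + 1) → CMType F) (p : ℕ) :
    ∃ r : LinearOrder (Emb (Fin (n + 1) → (F : Type))), @OrderConvention _ _ _ r (piCMType Θ) ∧
      Module.finrank ℚ (U.hodgeClassesOf (U.cmProd F Θ) p) = Module.finrank ℚ (@Bp _ _ _ _ r (piCMType Θ) p) := by
  obtain ⟨r, hr⟩ := exists_orderConvention (piCMType Θ)
  exact ⟨r, hr, @finrank_hodgeClassesOf_eq_finrank_Bp_CM_of_facts U M hN1 hN2 hN3 hN4 h6 F n Θ r hr p⟩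

end Universe

end HodgeCM

end
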